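import Summits.BirchSwinnertonDyer.BirchSwinnertonDyer.Theorems.AdditiveKolyvaginRoadKolyvaginVisibilityStep
import Summits.BirchSwinnertonDyer.BirchSwinnertonDyer.Theorems.AdditiveKolyvaginRoadChebOfMcCallum
import Summits.BirchSwinnertonDyer.BirchSwinnertonDyer.Theorems.AdditiveKolyvaginRoadKolyvaginGrossBridge
import HarnessLib

/-!
# Route `AdditiveKolyvaginRoad`, crux KS′ `LevelKolyvaginSystemsAdditive` (item stmt-BirchSwinnertonDyer-21396) ∕ KPA′ (21400):
# VISIBILITY AT `p` OF KOLYVAGIN CLASSES — one or two Čebotarev steps make a class of a Gross–Kolyvagin family NON-ZERO above `p`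
# (cell `pub/bsd-wall`, width seat `bsd-wall-akr-p2x-w3` g9; `--supports stmt-BirchSwinnertonDyer-21396`, helper; E-side engine lemma for the
# crux-ideate card `Cruxes/LevelKolyvaginSystemsAdditive/Ideas/visible-vertex-transfer.md`, lever (V); part 2 of 2, after
# `…KolyvaginVisibilityStep.lean`)

WHY. The card's lever (V) claims: one Čebotarev step upgrades any non-zero mod-`p` Kolyvagin class `c₀(n)` of the avatar to a `𝔭`-VISIBLE
`c₀(nℓ)` (non-zero localisation above `p`), by pairing `c₀(nℓ)` against a `p`-relaxed class of the level-`n` structure of the OPPOSITE sign.  Two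
gaps: (i) for `n ≠ 1` the reciprocity terms at the primes of `n` need the raw Kolyvagin classes to be TRANSVERSE above `n` (not available);
(ii) the existence of a relaxed partner of the PRESCRIBED sign needs `P⁺ ⊥ P⁻` for an abstract Poitou–Tate family (not available).  THIS FILE proves
the lever in a REPAIRED form free of both: start from the conductor-ONE class (`cl 1 ≠ 0`) and CASE-SPLIT on the sign of ONE visible `p`-relaxed
partner `r` of EITHER sign — opposite sign: one step `n = ℓ`; same sign: two steps `n = ℓ₁ℓ₂` with `loc_{λ₁} r = 0` (McCallum's Čebotarev with
vanishing pattern `(1, 0)`), which kills the `λ₁`-term of the reciprocity sum, so no transversality is ever needed.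

WHAT (namespace `…Theorems.AdditiveKoly`). `exists_not_mem_torsionLocalKer_above_of_kolyvaginFamily` — for a family `cl : ℕ → H¹(K, E[p])` with
Gross's three properties on square-free products of Zhang–Kolyvagin primes (sign `ε(−1)^{#n}`, Kummer off `n`, relation (8.1)
`cl n ∈ 𝓛_λ ↔ loc_λ cl(n/ℓ) = 0` — the shape of the named fact `Gross1991_kolyvaginClasses`), `cl 1 ≠ 0`, a finite set `Σ` of places above `p`
and ONE eigenclass `r` Kummer at `∞` and off `Σ`, detected at some place of `Σ`: some `cl n`, `n ∈ {1, ℓ, ℓ₁ℓ₂}` square-free of Zhang–Kolyvagin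
support avoiding any finite `T`, is detected at some place of `Σ`.  Nothing uses a reduction type at `p`: for a `p`-good avatar the Kummer
condition of `cl n` above `p` is Gross's Prop. 6.2 (1), inside the family hypothesis; the partner `r` is what Poitou–Tate exactness for the Kummer
structure relaxed above `p` supplies (the route's DUAL.2; not used here).

HONEST FRAMING: one theorem; 0 definitions, 0 named facts, 0 `sorry`; every hypothesis is a displayed binder; closes nothing.  BSD is not proved
by any of this; KS′ ∕ KPA′ stay OPEN at `p² ∣ N`; the card's other input DKL_n (derived Kriz–Li congruence at conductor `n`) is unprinted and
untouched.

References: [cite: GrossLMS1991, Prop. 5.4, Prop. 6.2, Prop. 8.2, §9] [cite: McCallumLMS1991, §3 Cor. 3.2, Lemma 5.3]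
[cite: WZhang2014, Lemma 8.1, Lemma 8.2, Lemma 8.4] [cite: MilneADT2006, Ch. I, Thm. 4.10].
-/

set_option linter.dupNamespace false -- single-conjunct summit repeats the name by design

noncomputable section

open scoped Classical

namespace Summit.BirchSwinnertonDyer.BirchSwinnertonDyer.Theorems.AdditiveKoly

open CategoryTheory WeierstrassCurve Field Function NumberField IsDedekindDomain
open Literature.NumberTheory.EllipticCurves Literature.NumberTheory.EllipticCurves.ModularForms
  Literature.NumberTheory.GaloisRepresentations Module
open Literature.NumberTheory.GaloisCohomology
open Summit.BirchSwinnertonDyer.Rank1Residual.X11b.Three.Koly.Method2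
open scoped ContRepresentation

/-! ## §3 The repaired lever (V): one or two Čebotarev steps make a class of a Gross–Kolyvagin family visible above `p` -/

section Lever

variable (W : WeierstrassCurve ℚ) (K : Type) [Field K] [NumberField K] (p : ℕ) [W.IsElliptic] [W.IsGloballyMinimal]
  [NeZero (W.conductorNorm ℤ)] [Fact p.Prime] (c : K ≃ₐ[ℚ] K)

/-- **VISIBILITY AT `p` AFTER AT MOST TWO ČEBOTAREV STEPS** (the lever (V) of the card `visible-vertex-transfer`, repaired).  Frame: `K` imaginary
quadratic, `p` odd, `ρ̄_{E,p}` onto, `c ≠ 1` (ANY reduction type of `E` at `p`).  Data: a family `cl : ℕ → H¹(K, E[p])` with Gross's three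
properties on the square-free products `n` of Zhang–Kolyvagin primes — SIGN `τ cl(n) = ε(−1)^{#n} cl(n)`, the KUMMER condition at the infinite
places and at the finite places `v ∌ n`, and the RELATION (8.1) `cl(n) ∈ 𝓛_λ ↔ loc_λ cl(n/ℓ) = 0` for `ℓ ∣ n`, `λ ∋ ℓ` (the shape of the named fact
`Gross1991_kolyvaginClasses`, Gross 1991 Prop. 5.4 ∕ 6.2) — with `cl 1 ≠ 0`; a finite set `Σ` of places above `p`; and ONE eigenclass `r` (any
sign `s`) Kummer at `∞` and off `Σ`, with non-zero localisation at some `w₀ ∈ Σ`.  Then some `cl n` — `n ∈ {1, ℓ, ℓ₁ℓ₂}` square-free, of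
Zhang–Kolyvagin support avoiding the finite set `T` — has NON-ZERO localisation at some place of `Σ`.
Proof.  If `cl 1` is visible on `Σ`, take `n = 1`.  Else `cl 1` vanishes on `Σ`.  OPPOSITE signs (`s = −ε`): McCallum's Čebotarev
(`exists_zhangKolyvaginPrime_notMem_of_eigenP`, pattern `(1,1)`) gives `ℓ ∉ T` with `loc_λ cl 1 ≠ 0 ≠ loc_λ r`; by (8.1) `cl ℓ` is not Kummer at `λ`,
and §2 with the pair `(r, cl ℓ)` (`Z = ∅`).  SAME sign (`s = ε`): `cl 1` and `r` are independent (`cl 1` vanishes at `w₀`, `r` does not), so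
pattern `(1,0)` gives `ℓ₁ ∉ T` with `loc_{λ₁} cl 1 ≠ 0 = loc_{λ₁} r`; `cl ℓ₁ ≠ 0` has sign `−ε`, pattern `(1,1)` gives `ℓ₂ ∉ T ∪ {ℓ₁}` with
`loc_{λ₂} cl ℓ₁ ≠ 0 ≠ loc_{λ₂} r`; by (8.1) `cl(ℓ₁ℓ₂)` (sign `ε`) is not Kummer at `λ₂`, and §2 with the pair `(r, cl(ℓ₁ℓ₂))`, `λ = λ₂`,
`Z = {λ₁}` — the `λ₁`-term dies because `loc_{λ₁} r = 0`.  No transversality of `cl` above its conductor is used.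
[cite: GrossLMS1991, Prop. 5.4, Prop. 6.2, Prop. 8.2, §9] [cite: McCallumLMS1991, §3 Cor. 3.2] [cite: WZhang2014, Lemma 8.1, Lemma 8.2] -/
theorem exists_not_mem_torsionLocalKer_above_of_kolyvaginFamily (hK : IsImaginaryQuadratic K) (hp2 : p ≠ 2)
    (hsurj : W.HasSurjectiveModNGaloisRep p) (hc : c ≠ 1)
    (cl : ℕ → Vp W K p) (ε : ℤ) (hε : ε = 1 ∨ ε = -1)
    (hsign : ∀ n : ℕ, Squarefree n → (∀ q ∈ n.primeFactors, Zhang2014.IsKolyvaginPrime (W.conductorNorm ℤ) W K p q) →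
      conjAct W c ((p ^ 1 : ℕ) : ℤ) (cl n) = (ε * (-1) ^ n.primeFactors.card) • cl n)
    (hfin : ∀ n : ℕ, Squarefree n → (∀ q ∈ n.primeFactors, Zhang2014.IsKolyvaginPrime (W.conductorNorm ℤ) W K p q) →
      ∀ v : HeightOneSpectrum (𝓞 K), (n : 𝓞 K) ∉ v.asIdeal →
        cl n ∈ selmerLocalKer (W.baseChange K) (v.adicCompletion K) ((p ^ 1 : ℕ) : ℤ))
    (hinf : ∀ n : ℕ, Squarefree n → (∀ q ∈ n.primeFactors, Zhang2014.IsKolyvaginPrime (W.conductorNorm ℤ) W K p q) →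
      ∀ w : InfinitePlace K, cl n ∈ selmerLocalKer (W.baseChange K) w.Completion ((p ^ 1 : ℕ) : ℤ))
    (hrel : ∀ n : ℕ, Squarefree n → (∀ q ∈ n.primeFactors, Zhang2014.IsKolyvaginPrime (W.conductorNorm ℤ) W K p q) →
      ∀ ℓ : ℕ, ℓ.Prime → ℓ ∣ n → ∀ v : HeightOneSpectrum (𝓞 K), (ℓ : 𝓞 K) ∈ v.asIdeal →
        (cl n ∈ selmerLocalKer (W.baseChange K) (v.adicCompletion K) ((p ^ 1 : ℕ) : ℤ) ↔
          cl (n / ℓ) ∈ (W.baseChange K).torsionLocalKer (v.adicCompletion K) ((p ^ 1 : ℕ) : ℤ)))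
    (h1 : cl 1 ≠ 0)
    (Sig : Finset (HeightOneSpectrum (𝓞 K))) (hSig : ∀ v ∈ Sig, ((p : ℕ) : 𝓞 K) ∈ v.asIdeal)
    (s : Bool) (r : Vp W K p) (hrs : conjAct W c ((p ^ 1 : ℕ) : ℤ) r = sgnP s • r)
    (hrinf : ∀ w : InfinitePlace K, r ∈ selmerLocalKer (W.baseChange K) w.Completion ((p ^ 1 : ℕ) : ℤ))
    (hrfin : ∀ v : HeightOneSpectrum (𝓞 K), v ∉ Sig →
      r ∈ selmerLocalKer (W.baseChange K) (v.adicCompletion K) ((p ^ 1 : ℕ) : ℤ))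
    {w₀ : HeightOneSpectrum (𝓞 K)} (hw₀ : w₀ ∈ Sig)
    (hr0 : r ∉ (W.baseChange K).torsionLocalKer (w₀.adicCompletion K) ((p ^ 1 : ℕ) : ℤ))
    (T : Finset {ℓ // Zhang2014.IsKolyvaginPrime (W.conductorNorm ℤ) W K p ℓ}) :
    ∃ n : ℕ, Squarefree n ∧ (∀ q ∈ n.primeFactors, Zhang2014.IsKolyvaginPrime (W.conductorNorm ℤ) W K p q) ∧
      (∀ q ∈ n.primeFactors, ∀ ℓ ∈ T, (ℓ : ℕ) ≠ q) ∧ n.primeFactors.card ≤ 2 ∧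
      ∃ w ∈ Sig, cl n ∉ (W.baseChange K).torsionLocalKer (w.adicCompletion K) ((p ^ 1 : ℕ) : ℤ) := by
  have hp : p.Prime := Fact.out
  -- ### Case 0: the conductor-one class is already visible on `Σ`
  by_cases h0 : ∃ w ∈ Sig, cl 1 ∉ (W.baseChange K).torsionLocalKer (w.adicCompletion K) ((p ^ 1 : ℕ) : ℤ)
  · obtain ⟨w, hw, hw'⟩ := h0
    exact ⟨1, squarefree_one, by simp [Nat.primeFactors_one], by simp [Nat.primeFactors_one],
      by simp [Nat.primeFactors_one], w, hw, hw'⟩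
  push Not at h0
  -- ### bookkeeping on Kolyvagin primes and the family
  have hsq1 : ∀ q ∈ (1 : ℕ).primeFactors, Zhang2014.IsKolyvaginPrime (W.conductorNorm ℤ) W K p q := by
    simp [Nat.primeFactors_one]
  have hx : conjAct W c ((p ^ 1 : ℕ) : ℤ) (cl 1) = ε • cl 1 := by
    have h := hsign 1 squarefree_one hsq1
    rw [Nat.primeFactors_one, Finset.card_empty, pow_zero, mul_one] at h
    exact h
  -- the Gross place of a Zhang–Kolyvagin prime, its uniqueness, and `p ∉ λ`
  have hG : ∀ ℓ : {ℓ // Zhang2014.IsKolyvaginPrime (W.conductorNorm ℤ) W K p ℓ},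
      IsKolyvaginPrime (W.conductorNorm ℤ) W K (p ^ 1) ℓ := fun ℓ ↦ isKolyvaginPrime_pow_one_of_zhang W K p hK hp2 hsurj ℓ.2
  have hpl : ∀ ℓ : {ℓ // Zhang2014.IsKolyvaginPrime (W.conductorNorm ℤ) W K p ℓ}, ∀ v : HeightOneSpectrum (𝓞 K),
      ((ℓ : ℕ) : 𝓞 K) ∈ v.asIdeal → v ∉ Sig := by
    intro ℓ v hv hvS
    have hcop : Nat.Coprime (ℓ : ℕ) p := (Nat.coprime_primes ℓ.2.1 hp).mpr ℓ.2.2.2.2.1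
    exact not_mem_asIdeal_of_coprime K hcop v hv (hSig v hvS)
  -- a prime `ℓ`: square-free, prime support `{ℓ}`
  have hsqℓ : ∀ ℓ : {ℓ // Zhang2014.IsKolyvaginPrime (W.conductorNorm ℤ) W K p ℓ}, Squarefree (ℓ : ℕ) := fun ℓ ↦
    ℓ.2.1.prime.squarefree
  have hpfℓ : ∀ ℓ : {ℓ // Zhang2014.IsKolyvaginPrime (W.conductorNorm ℤ) W K p ℓ}, (ℓ : ℕ).primeFactors = {(ℓ : ℕ)} := fun ℓ ↦
    ℓ.2.1.primeFactors
  have hKPℓ : ∀ ℓ : {ℓ // Zhang2014.IsKolyvaginPrime (W.conductorNorm ℤ) W K p ℓ},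
      ∀ q ∈ (ℓ : ℕ).primeFactors, Zhang2014.IsKolyvaginPrime (W.conductorNorm ℤ) W K p q := by
    intro ℓ q hq
    rw [hpfℓ ℓ, Finset.mem_singleton] at hq
    rw [hq]; exact ℓ.2
  -- the one-prime class `cl ℓ`: sign `−ε`; not Kummer at `λ` iff `cl 1` is detected at `λ`; Kummer off `λ`
  have hsignℓ : ∀ ℓ : {ℓ // Zhang2014.IsKolyvaginPrime (W.conductorNorm ℤ) W K p ℓ},
      conjAct W c ((p ^ 1 : ℕ) : ℤ) (cl ℓ) = (-ε) • cl ℓ := by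
    intro ℓ
    have h := hsign ℓ (hsqℓ ℓ) (hKPℓ ℓ)
    rw [hpfℓ ℓ, Finset.card_singleton, pow_one (-1 : ℤ), mul_neg_one] at h
    exact h
  have hnotKumℓ : ∀ ℓ : {ℓ // Zhang2014.IsKolyvaginPrime (W.conductorNorm ℤ) W K p ℓ}, ∀ v : HeightOneSpectrum (𝓞 K),
      ((ℓ : ℕ) : 𝓞 K) ∈ v.asIdeal → cl 1 ∉ (W.baseChange K).torsionLocalKer (v.adicCompletion K) ((p ^ 1 : ℕ) : ℤ) →
      cl ℓ ∉ selmerLocalKer (W.baseChange K) (v.adicCompletion K) ((p ^ 1 : ℕ) : ℤ) := by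
    intro ℓ v hv h1v hKum
    have h := (hrel ℓ (hsqℓ ℓ) (hKPℓ ℓ) ℓ ℓ.2.1 dvd_rfl v hv).mp hKum
    rw [Nat.div_self ℓ.2.1.pos] at h
    exact h1v h
  have hKumℓ : ∀ ℓ : {ℓ // Zhang2014.IsKolyvaginPrime (W.conductorNorm ℤ) W K p ℓ}, ∀ v : HeightOneSpectrum (𝓞 K),
      v ≠ (hG ℓ).place → cl ℓ ∈ selmerLocalKer (W.baseChange K) (v.adicCompletion K) ((p ^ 1 : ℕ) : ℤ) := by
    intro ℓ v hv
    exact hfin ℓ (hsqℓ ℓ) (hKPℓ ℓ) v (fun h ↦ hv ((hG ℓ).mem_iff.mp h))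
  -- `r ≠ 0`
  have hr_ne : r ≠ 0 := fun h ↦ hr0 (by rw [h]; exact zero_mem _)
  -- the two signs
  have hsgn : sgnP s = -ε ∨ sgnP s = ε := by
    rcases hε with h | h <;> cases s <;> simp [sgnP, h]
  rcases hsgn with hsA | hsB
  · -- ### Case A: `r` has the sign `−ε` of the one-prime classes — ONE step
    have hrs' : conjAct W c ((p ^ 1 : ℕ) : ℤ) r = (-ε) • r := by rw [hrs, hsA]
    -- Čebotarev, pattern (1,1), on the opposite-sign pair `(cl 1, r)`
    obtain ⟨ℓ, hℓT, hℓ⟩ := exists_zhangKolyvaginPrime_notMem_of_eigenP W K p c hK hp2 hsurj hc ![cl 1, r]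
      (fun i ↦ by
        fin_cases i
        · exact ⟨ε, hε, hx⟩
        · refine ⟨-ε, ?_, hrs'⟩
          rcases hε with h | h <;> simp [h])
      ![1, 1] (fun i ↦ by fin_cases i <;> simp)
      (fun a ha ↦ by
        simp only [Fin.sum_univ_two, Matrix.cons_val_zero, Matrix.cons_val_one] at ha
        have h := dvd_and_dvd_of_zsmul_add_zsmul_eq_zero_P W K p hp2 (conjAct W c ((p ^ 1 : ℕ) : ℤ)) hε hx hrs' h1 hr_ne ha
        intro i
        fin_cases i
        · exact h.1
        · exact h.2) T
    set lam := (hG ℓ).place with hlamdef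
    have hlam : ((ℓ : ℕ) : 𝓞 K) ∈ lam.asIdeal := (hG ℓ).mem_place
    have hx_lam : cl 1 ∉ (W.baseChange K).torsionLocalKer (lam.adicCompletion K) ((p ^ 1 : ℕ) : ℤ) := fun h ↦ by
      have := (hℓ 0 lam hlam).mp (by simpa using h)
      simp at this
    have hr_lam : r ∉ (W.baseChange K).torsionLocalKer (lam.adicCompletion K) ((p ^ 1 : ℕ) : ℤ) := fun h ↦ by
      have := (hℓ 1 lam hlam).mp (by simpa using h)
      simp at this
    have hys : conjAct W c ((p ^ 1 : ℕ) : ℤ) (cl ℓ) = sgnP s • cl ℓ := by rw [hsignℓ ℓ, hsA]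
    obtain ⟨w, hw, hyw, -⟩ := not_mem_torsionLocalKer_of_visiblePartner W K p c hK hp2 hsurj hc ℓ.2 lam hlam Sig ∅
      (hpl ℓ lam hlam) s hys hrs (hinf ℓ (hsqℓ ℓ) (hKPℓ ℓ)) (fun v hv _ ↦ hKumℓ ℓ v hv) (hnotKumℓ ℓ lam hlam hx_lam)
      hrinf hrfin (fun v hv ↦ absurd hv (Finset.notMem_empty v)) hr_lam
    refine ⟨ℓ, hsqℓ ℓ, hKPℓ ℓ, fun q hq ℓ' hℓ'T hq' ↦ hℓT ?_, by rw [hpfℓ ℓ, Finset.card_singleton]; omega, w, hw, hyw⟩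
    rw [hpfℓ ℓ, Finset.mem_singleton] at hq
    have : ℓ' = ℓ := Subtype.ext (hq'.trans hq)
    rw [← this]; exact hℓ'T
  · -- ### Case B: `r` has the sign `ε` of `cl 1` and of the two-prime classes — TWO steps
    have hrs' : conjAct W c ((p ^ 1 : ℕ) : ℤ) r = ε • r := by rw [hrs, hsB]
    -- `cl 1` (silent at `w₀`) and `r` (detected at `w₀`) are independent
    have hind : ∀ a : Fin 2 → ℤ, ∑ i, a i • (![cl 1, r] i) = 0 → ∀ i, (p : ℤ) ∣ a i := by
      intro a ha
      simp only [Fin.sum_univ_two, Matrix.cons_val_zero, Matrix.cons_val_one] at ha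
      have hb : (p : ℤ) ∣ a 1 := by
        by_contra hb
        have hbr : a 1 • r ∈ (W.baseChange K).torsionLocalKer (w₀.adicCompletion K) ((p ^ 1 : ℕ) : ℤ) := by
          have : a 1 • r = -(a 0 • cl 1) := eq_neg_of_add_eq_zero_right ha
          rw [this]
          exact neg_mem (AddSubgroup.zsmul_mem _ (h0 w₀ hw₀) _)
        have hcop : IsCoprime (p : ℤ) (a 1) := (Nat.prime_iff_prime_int.mp hp).irreducible.coprime_iff_not_dvd.mpr hb
        obtain ⟨u, v, huv⟩ := hcop
        apply hr0
        have : r = u • ((p : ℤ) • r) + v • (a 1 • r) := by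
          rw [← mul_zsmul, ← mul_zsmul, ← add_zsmul, huv, one_zsmul]
        rw [this, prime_smul_eq_zero W K p r, zsmul_zero, zero_add]
        exact AddSubgroup.zsmul_mem _ hbr _
      obtain ⟨k, hk⟩ := hb
      have hbr0 : a 1 • r = 0 := by rw [hk, mul_comm, mul_zsmul, prime_smul_eq_zero W K p r, zsmul_zero]
      rw [hbr0, add_zero] at ha
      have ha0 : (p : ℤ) ∣ a 0 := dvd_of_zsmul_eq_zero_P W K p h1 ha
      intro i
      fin_cases i
      · exact ha0
      · exact ⟨k, hk⟩
    -- first Čebotarev, pattern (1,0): `cl 1` detected, `r` silent at `λ₁`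
    obtain ⟨ℓ₁, hℓ₁T, hℓ₁⟩ := exists_zhangKolyvaginPrime_notMem_of_eigenP W K p c hK hp2 hsurj hc ![cl 1, r]
      (fun i ↦ by
        fin_cases i
        · exact ⟨ε, hε, hx⟩
        · exact ⟨ε, hε, hrs'⟩)
      ![1, 0] (fun i ↦ by fin_cases i <;> simp) hind T
    set lam₁ := (hG ℓ₁).place with hlam₁def
    have hlam₁ : ((ℓ₁ : ℕ) : 𝓞 K) ∈ lam₁.asIdeal := (hG ℓ₁).mem_place
    have hx_lam₁ : cl 1 ∉ (W.baseChange K).torsionLocalKer (lam₁.adicCompletion K) ((p ^ 1 : ℕ) : ℤ) := fun h ↦ by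
      have := (hℓ₁ 0 lam₁ hlam₁).mp (by simpa using h)
      simp at this
    have hr_lam₁ : r ∈ (W.baseChange K).torsionLocalKer (lam₁.adicCompletion K) ((p ^ 1 : ℕ) : ℤ) := by
      have := (hℓ₁ 1 lam₁ hlam₁).mpr (by simp)
      simpa using this
    -- `y₁ = cl ℓ₁ ≠ 0` of sign `−ε`
    have hy₁K : cl ℓ₁ ∉ selmerLocalKer (W.baseChange K) (lam₁.adicCompletion K) ((p ^ 1 : ℕ) : ℤ) :=
      hnotKumℓ ℓ₁ lam₁ hlam₁ hx_lam₁
    have hy₁ne : cl ℓ₁ ≠ 0 := fun h ↦ hy₁K (by rw [h]; exact zero_mem _)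
    -- second Čebotarev, pattern (1,1), on the opposite-sign pair `(cl ℓ₁, r)`, avoiding `ℓ₁`
    have hε' : (-ε) = 1 ∨ (-ε) = -1 := by rcases hε with h | h <;> simp [h]
    have hrs'' : conjAct W c ((p ^ 1 : ℕ) : ℤ) r = (-(-ε)) • r := by rw [neg_neg]; exact hrs'
    obtain ⟨ℓ₂, hℓ₂T, hℓ₂⟩ := exists_zhangKolyvaginPrime_notMem_of_eigenP W K p c hK hp2 hsurj hc ![cl ℓ₁, r]
      (fun i ↦ by
        fin_cases i
        · exact ⟨-ε, hε', hsignℓ ℓ₁⟩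
        · exact ⟨ε, hε, hrs'⟩)
      ![1, 1] (fun i ↦ by fin_cases i <;> simp)
      (fun a ha ↦ by
        simp only [Fin.sum_univ_two, Matrix.cons_val_zero, Matrix.cons_val_one] at ha
        have h := dvd_and_dvd_of_zsmul_add_zsmul_eq_zero_P W K p hp2 (conjAct W c ((p ^ 1 : ℕ) : ℤ)) hε' (hsignℓ ℓ₁) hrs''
          hy₁ne hr_ne ha
        intro i
        fin_cases i
        · exact h.1
        · exact h.2) (insert ℓ₁ T)
    have hℓ₂₁ : ℓ₂ ≠ ℓ₁ := fun h ↦ hℓ₂T (by rw [h]; exact Finset.mem_insert_self _ _)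
    have hℓ₂T' : ℓ₂ ∉ T := fun h ↦ hℓ₂T (Finset.mem_insert_of_mem h)
    have hne : (ℓ₂ : ℕ) ≠ (ℓ₁ : ℕ) := fun h ↦ hℓ₂₁ (Subtype.ext h)
    set lam₂ := (hG ℓ₂).place with hlam₂def
    have hlam₂ : ((ℓ₂ : ℕ) : 𝓞 K) ∈ lam₂.asIdeal := (hG ℓ₂).mem_place
    have hy₁_lam₂ : cl ℓ₁ ∉ (W.baseChange K).torsionLocalKer (lam₂.adicCompletion K) ((p ^ 1 : ℕ) : ℤ) := fun h ↦ by
      have := (hℓ₂ 0 lam₂ hlam₂).mp (by simpa using h)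
      simp at this
    have hr_lam₂ : r ∉ (W.baseChange K).torsionLocalKer (lam₂.adicCompletion K) ((p ^ 1 : ℕ) : ℤ) := fun h ↦ by
      have := (hℓ₂ 1 lam₂ hlam₂).mp (by simpa using h)
      simp at this
    -- the two-prime conductor `n = ℓ₁ ℓ₂`
    set n : ℕ := (ℓ₁ : ℕ) * (ℓ₂ : ℕ) with hndef
    have hcop : Nat.Coprime (ℓ₁ : ℕ) (ℓ₂ : ℕ) := (Nat.coprime_primes ℓ₁.2.1 ℓ₂.2.1).mpr (Ne.symm hne)
    have hsqn : Squarefree n := (Nat.squarefree_mul hcop).mpr ⟨hsqℓ ℓ₁, hsqℓ ℓ₂⟩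
    have hpfn : n.primeFactors = {(ℓ₁ : ℕ), (ℓ₂ : ℕ)} := by
      rw [hndef, Nat.Coprime.primeFactors_mul hcop, hpfℓ ℓ₁, hpfℓ ℓ₂]
      rfl
    have hKPn : ∀ q ∈ n.primeFactors, Zhang2014.IsKolyvaginPrime (W.conductorNorm ℤ) W K p q := by
      intro q hq
      rw [hpfn, Finset.mem_insert, Finset.mem_singleton] at hq
      rcases hq with rfl | rfl
      · exact ℓ₁.2
      · exact ℓ₂.2
    have hcardn : n.primeFactors.card = 2 := by rw [hpfn]; exact Finset.card_pair (Ne.symm hne)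
    -- `y₂ = cl n`: sign `ε`, not Kummer at `λ₂`, Kummer off `λ₁, λ₂`
    have hys : conjAct W c ((p ^ 1 : ℕ) : ℤ) (cl n) = sgnP s • cl n := by
      have h := hsign n hsqn hKPn
      rw [hcardn] at h
      rw [h, hsB]
      congr 1
      ring
    have hy₂K : cl n ∉ selmerLocalKer (W.baseChange K) (lam₂.adicCompletion K) ((p ^ 1 : ℕ) : ℤ) := by
      intro hKum
      have h := (hrel n hsqn hKPn ℓ₂ ℓ₂.2.1 (Dvd.intro_left _ rfl) lam₂ hlam₂).mp hKum
      rw [hndef, Nat.mul_div_cancel _ ℓ₂.2.1.pos] at h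
      exact hy₁_lam₂ h
    have hy₂fin : ∀ v : HeightOneSpectrum (𝓞 K), v ≠ lam₂ → v ∉ ({lam₁} : Finset (HeightOneSpectrum (𝓞 K))) →
        cl n ∈ selmerLocalKer (W.baseChange K) (v.adicCompletion K) ((p ^ 1 : ℕ) : ℤ) := by
      intro v hv₂ hv₁
      rw [Finset.mem_singleton] at hv₁
      refine hfin n hsqn hKPn v fun hmem ↦ ?_
      rw [hndef, Nat.cast_mul] at hmem
      rcases v.isPrime.mem_or_mem hmem with h | h
      · exact hv₁ ((hG ℓ₁).mem_iff.mp h)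
      · exact hv₂ ((hG ℓ₂).mem_iff.mp h)
    obtain ⟨w, hw, hyw, -⟩ := not_mem_torsionLocalKer_of_visiblePartner W K p c hK hp2 hsurj hc ℓ₂.2 lam₂ hlam₂ Sig {lam₁}
      (hpl ℓ₂ lam₂ hlam₂) s hys hrs (hinf n hsqn hKPn) hy₂fin hy₂K hrinf hrfin
      (fun v hv ↦ by rw [Finset.mem_singleton] at hv; rw [hv]; exact hr_lam₁) hr_lam₂
    refine ⟨n, hsqn, hKPn, fun q hq ℓ' hℓ'T hq' ↦ ?_, by rw [hcardn], w, hw, hyw⟩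
    rw [hpfn, Finset.mem_insert, Finset.mem_singleton] at hq
    rcases hq with rfl | rfl
    · exact hℓ₁T (by rw [← Subtype.ext hq']; exact hℓ'T)
    · exact hℓ₂T' (by rw [← Subtype.ext hq']; exact hℓ'T)

end Lever

end Summit.BirchSwinnertonDyer.BirchSwinnertonDyer.Theorems.AdditiveKoly

end
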